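import Mathlib
import HarnessLib
import Literature.MathematicalPhysics.StatisticalMechanics.RGStepSigmaABKM

/-!
# `σ(0) → L^dA_𝒫·abkmContrConst d L R` as `A → ∞` ([ABKM19] Ch. 12: the choice of the large-set
# parameter `A` after `L`)

`RGStepSigmaABKM.sigmaABKM_zero` displays `σ(0)` as the block-part contraction constant of `C_k`
(`L^dA_𝒫·abkmContrConst d L R`, Lemma 10.1) plus `2·largePartEps d L A A_𝒫 η` (Lemma 10.2) plus a multiple
of `g₂(0) ∝ A^{−(η−1)}`; all correction terms are `O(A^{−(1−1/η)}) + O(A^{−1}) + O(A^{−(η−1)})`.  Hence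

* **`tendsto_sigmaABKM_zero_atTop`** — `σ(0) → L^dA_𝒫·abkmContrConst d L R` as `A → ∞` (fixed `d, L, R, A_𝒫`);
* `exists_sigmaABKM_zero_lt` — for every `δ > 0` there is `A₀` with `σ(0) < L^dA_𝒫·abkmContrConst + δ` for
  `A ≥ A₀`.

Together with `exists_sigmaABKM_lt` (`r → 0` at fixed `A`) this is the parameter choice "`L`, then `A`,
then `r`" making `σ ≤ κη` in `RGFlow.exists_tuned_of_normBound` once `L^dA_𝒫·abkmContrConst d L R < κη`.

Everything is proved; no named fact.

## References
* S. Adams, S. Buchholz, R. Kotecký, S. Müller, arXiv:1910.13564, Lemmas 10.1–10.2, proof of Theorem 12.1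
  [AdamsBuchholzKoteckyMuller2019].
-/

noncomputable section

namespace Literature.MathematicalPhysics.StatisticalMechanics.GradientRG

open scoped BigOperators Classical Topology
open Filter

/-- **`σ(0) → L^dA_𝒫·abkmContrConst d L R` as `A → ∞`.** [cite: AdamsBuchholzKoteckyMuller2019, proof of Theorem 12.1] -/
theorem tendsto_sigmaABKM_zero_atTop (d L R : ℕ) (A𝒫 : ℝ) :
    Tendsto (fun A : ℝ => sigmaABKM d L R A A𝒫 0) atTop
      (𝓝 ((L : ℝ) ^ d * (A𝒫 * abkmContrConst d L R))) := by
  have hc : (0 : ℝ) < (2 * (2 ^ d + 1) + 6 : ℝ) ^ d := by positivity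
  have hη : 0 < (1 + 1 / ((2 * (2 ^ d + 1) + 6 : ℝ) ^ d)) - 1 := by
    have e : (1 + 1 / ((2 * (2 ^ d + 1) + 6 : ℝ) ^ d)) - 1 = 1 / ((2 * (2 ^ d + 1) + 6 : ℝ) ^ d) := by ring
    rw [e]; positivity
  have hη' : 0 < 1 - (1 + 1 / ((2 * (2 ^ d + 1) + 6 : ℝ) ^ d))⁻¹ := by
    have e : 1 - (1 + 1 / ((2 * (2 ^ d + 1) + 6 : ℝ) ^ d))⁻¹ = (1 / ((2 * (2 ^ d + 1) + 6 : ℝ) ^ d)) / (1 + 1 / ((2 * (2 ^ d + 1) + 6 : ℝ) ^ d)) := by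
      field_simp
      ring
    rw [e]; positivity
  have h1 : Tendsto (fun A : ℝ => A⁻¹) atTop (𝓝 0) := tendsto_inv_atTop_zero
  have h2 : Tendsto (fun A : ℝ => A ^ (-((1 + 1 / ((2 * (2 ^ d + 1) + 6 : ℝ) ^ d)) - 1) : ℝ)) atTop (𝓝 0) := tendsto_rpow_neg_atTop hη
  have h3 : Tendsto (fun A : ℝ => A ^ (-(1 - (1 + 1 / ((2 * (2 ^ d + 1) + 6 : ℝ) ^ d))⁻¹) : ℝ)) atTop (𝓝 0) := tendsto_rpow_neg_atTop hη'
  have hfun : (fun A : ℝ => sigmaABKM d L R A A𝒫 0) = fun A : ℝ =>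
      (L : ℝ) ^ d * (A𝒫 * abkmContrConst d L R) +
        (2 * (2 : ℝ) ^ (L ^ d) * A𝒫) * A ^ (-(1 - (1 + 1 / ((2 * (2 ^ d + 1) + 6 : ℝ) ^ d))⁻¹) : ℝ) +
        (2 * (L : ℝ) ^ d * smallPolymerConst d * A𝒫 ^ 2) * A⁻¹ +
        ((64 * Real.exp (3 / 8) + 1) * ((1 + Real.exp (1 / 4)) ^ (L ^ d) * ((2 * (1 + Real.exp (1 / 4)) * max 1 A𝒫) ^ ((2 ^ (d + 1) + 2) ^ d * L ^ d) * (2 : ℝ) ^ ((2 ^ (d + 1) + 2) ^ d * L ^ d)))) * A ^ (-((1 + 1 / ((2 * (2 ^ d + 1) + 6 : ℝ) ^ d)) - 1) : ℝ) +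
        (32 * Real.exp (3 / 8) * pi2BoundConst d (((2 * R + 2 : ℕ) : ℝ) + ((d / 2 + 1 : ℕ) : ℝ)) * A𝒫 * ((1 + Real.exp (1 / 4)) ^ (L ^ d) * ((2 * (1 + Real.exp (1 / 4)) * max 1 A𝒫) ^ ((2 ^ (d + 1) + 2) ^ d * L ^ d) * (2 : ℝ) ^ ((2 ^ (d + 1) + 2) ^ d * L ^ d)))) * (A⁻¹ * A ^ (-((1 + 1 / ((2 * (2 ^ d + 1) + 6 : ℝ) ^ d)) - 1) : ℝ)) := by
    funext A
    rw [sigmaABKM_zero]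
    unfold largePartEps
    push_cast
    ring
  rw [hfun]
  have key := ((((tendsto_const_nhds (x := (L : ℝ) ^ d * (A𝒫 * abkmContrConst d L R)) (f := (atTop : Filter ℝ))).add
    (h3.const_mul (2 * (2 : ℝ) ^ (L ^ d) * A𝒫))).add (h1.const_mul (2 * (L : ℝ) ^ d * smallPolymerConst d * A𝒫 ^ 2))).add
    (h2.const_mul ((64 * Real.exp (3 / 8) + 1) * ((1 + Real.exp (1 / 4)) ^ (L ^ d) * ((2 * (1 + Real.exp (1 / 4)) * max 1 A𝒫) ^ ((2 ^ (d + 1) + 2) ^ d * L ^ d) * (2 : ℝ) ^ ((2 ^ (d + 1) + 2) ^ d * L ^ d)))))).add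
    ((h1.mul h2).const_mul (32 * Real.exp (3 / 8) * pi2BoundConst d (((2 * R + 2 : ℕ) : ℝ) + ((d / 2 + 1 : ℕ) : ℝ)) * A𝒫 * ((1 + Real.exp (1 / 4)) ^ (L ^ d) * ((2 * (1 + Real.exp (1 / 4)) * max 1 A𝒫) ^ ((2 ^ (d + 1) + 2) ^ d * L ^ d) * (2 : ℝ) ^ ((2 ^ (d + 1) + 2) ^ d * L ^ d)))))
  simpa using key

/-- **`σ(0) < L^dA_𝒫·abkmContrConst + δ` for `A` large.** [cite: AdamsBuchholzKoteckyMuller2019, proof of Theorem 12.1] -/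
theorem exists_sigmaABKM_zero_lt (d L R : ℕ) (A𝒫 : ℝ) {δ : ℝ} (hδ : 0 < δ) :
    ∃ A₀ : ℝ, ∀ A : ℝ, A₀ ≤ A → sigmaABKM d L R A A𝒫 0 < (L : ℝ) ^ d * (A𝒫 * abkmContrConst d L R) + δ := by
  have h := (tendsto_sigmaABKM_zero_atTop d L R A𝒫).eventually (Iio_mem_nhds (lt_add_of_pos_right _ hδ))
  obtain ⟨A₀, hA₀⟩ := Filter.eventually_atTop.1 h
  exact ⟨A₀, fun A hA => hA₀ A hA⟩

end Literature.MathematicalPhysics.StatisticalMechanics.GradientRG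

end
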